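import Literature.Topology.FourManifolds.CoupleLevelTransport

/-!
# Level maps of a couple and the exit transports of its saddles

Topic `Literature/Topology/FourManifolds` (sixth file of the *structure conjugacy* of two
one-level Morse data on a handlebody, support of `stmt-SmoothPoincare4-15190`; the two-function
analogue of `PairSaddleRegions.lean`).  Everything here is **proved**; the new definitions are
bookkeeping.

For a couple `C : BasinCouple g_A g_B ξ_A ξ_B` with saddle data `Q : C.SaddleData`
(`CoupleSaddles.lean`: one-level data `QA`, `QB` of the same size `ε`, values `c_A`, `c_B`,
bijection `σ`, model conjugations `MC s`):

* `SaddleData.LevelMap Q` — **a level map** `lam` with inverse `lam'`: smooth strictly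
  increasing bijections of `ℝ` which are the *bottom shift* `ℓ ↦ ℓ + (g_B p₀' - g_A p₀)` below
  `sph_A`, the *box shift* `ℓ ↦ ℓ + (c_B - c_A)` on `[c_A - 9ε², c_A + 9ε²]`, and the identity
  from `L` on; `LevelMap.swap`; consequences (`lam c_A = c_B`, `lam L = L`, `lam sphR_A = sphR_B`,
  images of the intervals `(g_A p₀, c_A)`, `(c_A, hi)`);
* `SaddleData.refExit Q M s δ : C.RefData M.lam` — **the exit piece of the saddle `s`**: reference
  level `c_A + ε²`, reference piece the exit annulus `QA.Uexit s δ`, served levels `(c_A, hi)`,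
  reference map `MC s`; its domain **is the domain of the one-function exit piece**
  (`dom_refExit_eq`, so the covering and separation lemmas of `PairSaddleCover.lean` apply
  verbatim); the exit piece of the swapped data at `σ s` inverts it (`LT_refExit_swap_LT`);
* bookkeeping: points below `c_A` lie in the basin of `A` (`mem_basin_of_apply_lt_c`); the cone
  map is determined by the `B`-ray of the image direction (`coneMap_eq_of_exists_θ`).

## References

* J. Milnor, *Lectures on the h-cobordism theorem* (1965), Def. 3.1, Thm. 4.1, proofs of
  Thms. 3.12–3.13 (PDF pp. 12, 17–22). [MilnorHCobordism1965]
-/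

open scoped Manifold ContDiff Topology
open Set Function Filter Metric

noncomputable section

namespace Literature.Topology.FourManifolds

open Cobordism FourManifolds.Flow

universe u

variable {n : ℕ} {W : Type u} [TopologicalSpace W] [T2Space W] [SecondCountableTopology W]
  [CompactSpace W] [ChartedSpace (EuclideanHalfSpace (n + 1)) W] [IsManifold (𝓡∂ (n + 1)) ∞ W]

/-! ### Points below the saddle value lie in the basin -/

namespace BasinPair.SaddleData

variable {g : W → ℝ} {ξA ξB : Π x : W, TangentSpace (𝓡∂ (n + 1)) x} {P : BasinPair g ξA ξB} (Q : P.SaddleData)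

/-- **A point of level `< c` lies in the basin of the minimum**: its backward orbit converges to a
critical point of level `≤ g x < c`, which can only be `p₀`. [cite: MilnorHCobordism1965, Def. 3.9, Thm. 4.1] -/
theorem mem_basin_of_apply_lt_c {x : W} (hx : g x < Q.c) : x ∈ P.A.basin := by
  obtain ⟨p, hp, hpx, -, hxp⟩ := P.A.exists_tendsto_atBot (x := x) (hx.trans Q.c_lt_hi).le
  rcases Q.isMCriticalPt_cases hp with h | h
  · rw [BasinSetting.mem_basin_iff, ← h]; exact hxp
  · rw [h] at hpx; exact absurd hx (not_lt.2 hpx)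

/-- Points of the entrance domains lie in the basin. [folklore] -/
theorem mem_basin_of_mem_dom_refEnt {s : SaddlePt n g} {δ : ℝ} {x : W} (hx : x ∈ (Q.refEnt s δ).dom) :
    x ∈ P.A.basin := Q.mem_basin_of_apply_lt_c hx.1.2

end BasinPair.SaddleData

namespace BasinCouple

variable {gA gB : W → ℝ} {ξA ξB : Π x : W, TangentSpace (𝓡∂ (n + 1)) x} {C : BasinCouple gA gB ξA ξB}

namespace SaddleData

variable (Q : C.SaddleData)

/-! ### Level maps -/

/-- **A level map of the saddle data of a couple**: a smooth strictly increasing bijection `lam`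
of `ℝ` with smooth strictly increasing inverse `lam'`, equal to the bottom shift below `sph_A`,
to the box shift on `[c_A - 9ε², c_A + 9ε²]`, and to the identity from `L` on. [cite: MilnorHCobordism1965, Thm. 4.1 (PDF p. 22)] -/
structure LevelMap where
  /-- the level map -/
  lam : ℝ → ℝ
  /-- its inverse -/
  lam' : ℝ → ℝ
  /-- `lam` is smooth -/
  contDiff_lam : ContDiff ℝ ∞ lam
  /-- `lam'` is smooth -/
  contDiff_lam' : ContDiff ℝ ∞ lam'
  /-- `lam` is strictly increasing -/
  strictMono_lam : StrictMono lam
  /-- `lam'` is strictly increasing -/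
  strictMono_lam' : StrictMono lam'
  /-- `lam' ∘ lam = id` -/
  lam'_lam : ∀ ℓ, lam' (lam ℓ) = ℓ
  /-- `lam ∘ lam' = id` -/
  lam_lam' : ∀ ℓ, lam (lam' ℓ) = ℓ
  /-- the bottom shift -/
  lam_of_le_sph : ∀ ℓ, ℓ ≤ C.A.sph → lam ℓ = ℓ + (gB C.B.p₀ - gA C.A.p₀)
  /-- the box shift -/
  lam_of_abs_le : ∀ ℓ, |ℓ - Q.QA.c| ≤ 9 * Q.QA.ε ^ 2 → lam ℓ = ℓ + (Q.QB.c - Q.QA.c)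
  /-- the identity from `L` on -/
  lam_of_L_le : ∀ ℓ, C.A.L ≤ ℓ → lam ℓ = ℓ

namespace LevelMap

variable {Q} (M : Q.LevelMap)

/-- `lam` is injective. [folklore] -/
theorem lam_injective : Injective M.lam := M.strictMono_lam.injective

/-- `lam` at the minimum value. [folklore] -/
theorem lam_apply_p₀ : M.lam (gA C.A.p₀) = gB C.B.p₀ := by
  rw [M.lam_of_le_sph _ C.A.apply_p₀_lt_sph.le]; ring

/-- `lam` at the saddle value. [folklore] -/
theorem lam_c : M.lam Q.QA.c = Q.QB.c := by
  rw [M.lam_of_abs_le _ (by rw [sub_self, abs_zero]; positivity)]; ring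

/-- `lam` at `L`. [folklore] -/
theorem lam_L : M.lam C.A.L = C.A.L := M.lam_of_L_le _ le_rfl

/-- `lam` at `hi`. [folklore] -/
theorem lam_hi : M.lam C.A.hi = C.A.hi := M.lam_of_L_le _ C.A.L_lt_hi.le

/-- `lam` at the levels of the small spheres. [folklore] -/
theorem lam_sphR : M.lam C.A.sphR = C.B.sphR := by
  rw [M.lam_of_le_sph _ C.A.sphR_le_sph, C.sphR_eq]

/-- `lam` at the levels `sph`. [folklore] -/
theorem lam_sph : M.lam C.A.sph = C.B.sph := by
  rw [M.lam_of_le_sph _ le_rfl, C.sph_eq]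

/-- **`lam` carries `(g_A p₀, c_A)` onto levels in `(g_B p₀', c_B)`.** [folklore] -/
theorem lam_mem_Ioo_p₀_c {ℓ : ℝ} (h : ℓ ∈ Ioo (gA C.A.p₀) Q.QA.c) : M.lam ℓ ∈ Ioo (gB C.B.p₀) Q.QB.c := by
  rw [← M.lam_apply_p₀, ← M.lam_c]; exact ⟨M.strictMono_lam h.1, M.strictMono_lam h.2⟩

/-- **`lam` carries `(c_A, hi)` into `(c_B, hi)`.** [folklore] -/
theorem lam_mem_Ioo_c_hi {ℓ : ℝ} (h : ℓ ∈ Ioo Q.QA.c C.A.hi) : M.lam ℓ ∈ Ioo Q.QB.c C.B.hi := by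
  rw [← M.lam_c, C.hi_eq, ← M.lam_hi]; exact ⟨M.strictMono_lam h.1, M.strictMono_lam h.2⟩

/-- `lam` carries `(g_A p₀, hi)` into `(g_B p₀', hi)`. [folklore] -/
theorem lam_mem_Ioo_p₀_hi {ℓ : ℝ} (h : ℓ ∈ Ioo (gA C.A.p₀) C.A.hi) : M.lam ℓ ∈ Ioo (gB C.B.p₀) C.B.hi := by
  rw [← M.lam_apply_p₀, C.hi_eq, ← M.lam_hi]; exact ⟨M.strictMono_lam h.1, M.strictMono_lam h.2⟩

/-- `lam` carries `(g_A p₀, hi)` into the open slab of `B`. [folklore] -/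
theorem lam_mem_Ioo_lo_hi {ℓ : ℝ} (h : ℓ ∈ Ioo (gA C.A.p₀) C.A.hi) : M.lam ℓ ∈ Ioo C.B.lo C.B.hi :=
  C.B.Ioo_subset_Ioo_lo (M.lam_mem_Ioo_p₀_hi h)

/-- `lam` is smooth at every level. [folklore] -/
theorem contDiffAt_lam (ℓ : ℝ) : ContDiffAt ℝ ∞ M.lam ℓ := M.contDiff_lam.contDiffAt

/-- `lam ℓ ≤ L` iff `ℓ ≤ L`. [folklore] -/
theorem lam_le_L_iff {ℓ : ℝ} : M.lam ℓ ≤ C.B.L ↔ ℓ ≤ C.A.L := by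
  rw [C.L_eq]
  conv_lhs => rw [← M.lam_L]
  exact M.strictMono_lam.le_iff_le

/-- The box shift on the levels of the `3ε`-ball. [folklore] -/
theorem lam_of_abs_le_sq {ℓ : ℝ} (h : |ℓ - Q.QA.c| ≤ Q.QA.ε ^ 2) : M.lam ℓ = ℓ + (Q.QB.c - Q.QA.c) :=
  M.lam_of_abs_le ℓ (h.trans (by nlinarith [Q.QA.ε_pos]))

/-- The inverse at the bottom. [folklore] -/
theorem lam'_of_le_sph {ℓ : ℝ} (h : ℓ ≤ C.B.sph) : M.lam' ℓ = ℓ + (gA C.A.p₀ - gB C.B.p₀) := by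
  have h1 : M.lam (ℓ + (gA C.A.p₀ - gB C.B.p₀)) = ℓ := by
    rw [M.lam_of_le_sph _ (by rw [C.sph_eq] at h; linarith)]; ring
  rw [← h1, M.lam'_lam, h1]

/-- The inverse on the box levels. [folklore] -/
theorem lam'_of_abs_le {ℓ : ℝ} (h : |ℓ - Q.QB.c| ≤ 9 * Q.QA.ε ^ 2) : M.lam' ℓ = ℓ + (Q.QA.c - Q.QB.c) := by
  have h1 : M.lam (ℓ + (Q.QA.c - Q.QB.c)) = ℓ := by
    rw [M.lam_of_abs_le _ (by rw [show ℓ + (Q.QA.c - Q.QB.c) - Q.QA.c = ℓ - Q.QB.c by ring]; exact h)]; ring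
  rw [← h1, M.lam'_lam, h1]

/-- The inverse from `L` on. [folklore] -/
theorem lam'_of_L_le {ℓ : ℝ} (h : C.B.L ≤ ℓ) : M.lam' ℓ = ℓ := by
  have h1 : M.lam ℓ = ℓ := M.lam_of_L_le _ (by rw [C.L_eq] at h; exact h)
  conv_lhs => rw [← h1]
  exact M.lam'_lam ℓ

/-- **The level map of the swapped data**: `lam'` with inverse `lam`. [folklore] -/
def swap : Q.swap.LevelMap where
  lam := M.lam'
  lam' := M.lam
  contDiff_lam := M.contDiff_lam'
  contDiff_lam' := M.contDiff_lam
  strictMono_lam := M.strictMono_lam'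
  strictMono_lam' := M.strictMono_lam
  lam'_lam := M.lam_lam'
  lam_lam' := M.lam'_lam
  lam_of_le_sph ℓ h := M.lam'_of_le_sph h
  lam_of_abs_le ℓ h := M.lam'_of_abs_le (by
    have h' : |ℓ - Q.QB.c| ≤ 9 * Q.QB.ε ^ 2 := h
    rw [Q.εB_eq] at h'; exact h')
  lam_of_L_le ℓ h := M.lam'_of_L_le h

/-- The swapped level map is `lam'`. [folklore] -/
@[simp] theorem swap_lam : M.swap.lam = M.lam' := rfl

/-- The inverse of the swapped level map is `lam`. [folklore] -/
@[simp] theorem swap_lam' : M.swap.lam' = M.lam := rfl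

/-- Swapping twice gives back the level map. [folklore] -/
@[simp] theorem swap_swap : M.swap.swap = M := rfl

end LevelMap

/-! ### The exit pieces -/

variable {Q} (M : Q.LevelMap)

/-- The exit reference level `c_A + ε²` maps to `c_B + ε²`. [folklore] -/
theorem lam_c_add_sq : M.lam (Q.QA.c + Q.QA.ε ^ 2) = Q.QB.c + Q.QA.ε ^ 2 := by
  rw [M.lam_of_abs_le_sq (by rw [add_sub_cancel_left, abs_of_pos Q.QA.sq_pos])]; ring

/-- A level other than `c_B` above `g_B p₀'`, as carried by `MC`: the image is non-critical. [folklore] -/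
theorem not_isMCriticalPt_MC {s : SaddlePt n gA} {z : W} (hz : z ∈ (Q.QA.DA s).chartBall (3 * Q.QA.ε))
    (h₁ : gB C.B.p₀ < gA z + (Q.QB.c - Q.QA.c)) (h₂ : gA z ≠ Q.QA.c) :
    ¬ IsMCriticalPt (𝓡∂ (n + 1)) gB (Q.MC s z) :=
  Q.QB.not_isMCriticalPt_of_apply (by rw [Q.apply_MC hz.1 hz.2.le]; exact h₁)
    (by rw [Q.apply_MC hz.1 hz.2.le]; intro h; exact h₂ (by linarith))

variable (Q) in
/-- **The reference data of the exit piece of the saddle `s`** along the level map `M`: level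
`c_A + ε²`, the exit annulus of width `δ`, served levels `(c_A, hi)`, reference map `MC s`. [cite: MilnorHCobordism1965, proof of Thm. 3.13 (PDF pp. 18–19)] -/
def refExit (s : SaddlePt n gA) (δ : ℝ) : C.RefData M.lam where
  ℓ₀ := Q.QA.c + Q.QA.ε ^ 2
  U := Q.QA.Uexit s δ
  isOpen_U := Q.QA.isOpen_Uexit s δ
  I₀ := Ioo Q.QA.c C.A.hi
  isOpen_I₀ := isOpen_Ioo
  ℓ₀_mem := ⟨lt_add_of_pos_right _ Q.QA.sq_pos, Q.QA.c_add_sq_lt_hi⟩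
  I₀_subset := Q.QA.Ioo_c_hi_subset
  lam_mem ℓ hℓ := M.lam_mem_Ioo_lo_hi (Q.QA.Ioo_c_hi_subset hℓ)
  contDiffAt_lam ℓ _ := M.contDiffAt_lam ℓ
  Φ := Q.MC s
  apply_Φ w hw hwℓ := by rw [Q.apply_MC hw.1.1 hw.1.2.le, hwℓ, lam_c_add_sq]; ring
  hits_Φ w hw hwℓ ℓ hℓ := by
    have h1 : gB (Q.MC s w) ∈ Ioo Q.QB.c C.B.hi := by
      rw [Q.apply_MC hw.1.1 hw.1.2.le, hwℓ]
      refine ⟨by linarith [Q.QA.sq_pos], ?_⟩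
      have := Q.lt_collar_B; have := C.B.one_sub_a'_lt_L; have := C.B.L_lt_hi; rw [C.a'_eq] at *
      nlinarith [Q.QA.sq_pos]
    exact Q.QB.hits_A_of_mem_Ioo_c_hi h1 (M.lam_mem_Ioo_c_hi hℓ)
  reg_Φ w hw hwℓ := Q.not_isMCriticalPt_MC hw.1
    (by rw [hwℓ]; have h1 : gB C.B.p₀ < Q.QB.c := Q.QB.apply_p₀_lt_c; linarith [Q.QA.sq_pos])
    (by rw [hwℓ]; exact ne_of_gt (lt_add_of_pos_right _ Q.QA.sq_pos))
  contMDiffAt_Φ w hw _ := Q.contMDiffAt_MC hw.1.1 hw.1.2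

/-- The reference level of the exit piece. [folklore] -/
@[simp] theorem refExit_ℓ₀ (s : SaddlePt n gA) (δ : ℝ) : (Q.refExit M s δ).ℓ₀ = Q.QA.c + Q.QA.ε ^ 2 := rfl

/-- The reference set of the exit piece. [folklore] -/
@[simp] theorem refExit_U (s : SaddlePt n gA) (δ : ℝ) : (Q.refExit M s δ).U = Q.QA.Uexit s δ := rfl

/-- The served levels of the exit piece. [folklore] -/
@[simp] theorem refExit_I₀ (s : SaddlePt n gA) (δ : ℝ) : (Q.refExit M s δ).I₀ = Ioo Q.QA.c C.A.hi := rfl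

/-- The reference map of the exit piece. [folklore] -/
@[simp] theorem refExit_Φ (s : SaddlePt n gA) (δ : ℝ) : (Q.refExit M s δ).Φ = Q.MC s := rfl

/-- **The domain of the exit piece is the domain of the one-function exit piece of `QA`** (same
reference level, set and served levels). [folklore] -/
theorem dom_refExit_eq (s : SaddlePt n gA) (δ : ℝ) : (Q.refExit M s δ).dom = (Q.QA.refExit s δ).dom := rfl

/-- Membership in the domain of the exit piece. [folklore] -/
theorem mem_dom_refExit_iff {s : SaddlePt n gA} {δ : ℝ} {x : W} : x ∈ (Q.refExit M s δ).dom ↔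
    gA x ∈ Ioo Q.QA.c C.A.hi ∧ ¬ IsMCriticalPt (𝓡∂ (n + 1)) gA x ∧ Hits C.A.θ gA (Q.QA.c + Q.QA.ε ^ 2) x ∧
      levelProj C.A.θ gA (Q.QA.c + Q.QA.ε ^ 2) x ∈ Q.QA.Uexit s δ := Iff.rfl

/-- A point between `c_A` and `hi` whose `ξ_A`-level point at `c_A + ε²` lies in the exit set is in
the domain of the exit piece. [folklore] -/
theorem mem_dom_refExit {s : SaddlePt n gA} {δ : ℝ} {x : W} (hx : gA x ∈ Ioo Q.QA.c C.A.hi)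
    (hU : levelProj C.A.θ gA (Q.QA.c + Q.QA.ε ^ 2) x ∈ Q.QA.Uexit s δ) : x ∈ (Q.refExit M s δ).dom :=
  Q.QA.mem_dom_refExit hx hU

/-- The domains of the exit pieces grow with the width. [folklore] -/
theorem dom_refExit_mono (s : SaddlePt n gA) {δ δ' : ℝ} (h : δ ≤ δ') : (Q.refExit M s δ).dom ⊆ (Q.refExit M s δ').dom :=
  Q.QA.dom_refExit_mono s h

/-! ### Swapping -/

/-- **The exit set is carried by `MC` into the exit set of `σ s`** (coordinates are preserved). [folklore] -/
theorem MC_mem_Uexit {s : SaddlePt n gA} {δ : ℝ} {z : W} (hz : z ∈ Q.QA.Uexit s δ) :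
    Q.MC s z ∈ Q.QB.Uexit (Q.σ s) δ := by
  refine ⟨?_, ?_⟩
  · have h := Q.MC_mem_chartBall le_rfl hz.1
    rw [← Q.εB_eq] at h; exact h
  · show sqSumLT (Q.QB.DA (Q.σ s)).k ((Q.QB.DA (Q.σ s)).coord (Q.MC s z)) < δ
    rw [Q.sqSumLT_coord_MC hz.1.2.le]; exact hz.2

/-- **The exit transport of the swapped data at `σ s` inverts the exit transport at `s`** on the
domain, and carries it into its own domain. [cite: MilnorHCobordism1965, Thm. 4.1 (PDF p. 22)] -/
theorem LT_refExit_swap_LT {s : SaddlePt n gA} {δ : ℝ} {x : W} (hx : x ∈ (Q.refExit M s δ).dom) :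
    (Q.refExit M s δ).LT x ∈ (Q.swap.refExit M.swap (Q.σ s) δ).dom ∧
      (Q.swap.refExit M.swap (Q.σ s) δ).LT ((Q.refExit M s δ).LT x) = x := by
  refine RefData.LT_LT_of_inverse (Q.swap.refExit M.swap (Q.σ s) δ) ?_ (fun ℓ _ => M.lam'_lam ℓ)
    (fun w hw _ => Q.MC_mem_Uexit hw) (fun w hw _ => ?_) hx ?_
  · show Q.QB.c + Q.QB.ε ^ 2 = M.lam (Q.QA.c + Q.QA.ε ^ 2)
    rw [lam_c_add_sq, Q.εB_eq]
  · show Q.swap.MC (Q.σ s) (Q.MC s w) = w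
    rw [Q.swap_MC]; exact Q.MCi_MC hw.1.1 hw.1.2.le
  · show M.lam (gA x) ∈ Ioo Q.QB.c C.B.hi
    exact M.lam_mem_Ioo_c_hi hx.1

end SaddleData

/-! ### The cone map and rays -/

/-- **The cone map is determined by the `B`-ray of the image direction**: a point `y` of level
`lam (g_A x)` on the `B`-trajectory of a point `w` of the `B`-basin with direction `T (dir_A x)`
is `coneMap x`. [cite: MilnorHCobordism1965, Def. 3.9, Thm. 4.1] -/
theorem coneMap_eq_of_exists_θ {T : EuclideanSpace ℝ (Fin (n + 1)) → EuclideanSpace ℝ (Fin (n + 1))} {lam : ℝ → ℝ}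
    {x w y : W} (hw : w ∈ C.B.basin) (hw0 : w ≠ C.B.p₀) (hwhi : gB w < C.B.hi) (hdir : C.B.dir w = T (C.A.dir x))
    (hy : ∃ t, C.B.θ (t, w) = y) (hgy : gB y = lam (gA x)) (hyhi : lam (gA x) ∈ Ioo (gB C.B.p₀) C.B.hi) :
    C.A.coneMap C.B T lam x = y := by
  obtain ⟨t, rfl⟩ := hy
  obtain ⟨hn, hh, hc⟩ := C.B.exists_eq_conePt_of_mem_basin hw hw0 hwhi
  have hwnc : ¬ IsMCriticalPt (𝓡∂ (n + 1)) gB w := C.B.not_isMCriticalPt_of_mem_basin hw hw0 hwhi.le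
  have hsph : Hits C.B.θ gB C.B.sphR w := C.B.hits_sphR_of_mem_basin hw hw0 hwhi.le
  -- the point of level `lam (g_A x)` on the trajectory of `w`
  have h1 : levelProj C.B.θ gB (lam (gA x)) w = C.B.θ (t, w) :=
    C.B.levelProj_eq_θ_of_apply_eq hwnc (Ioo_subset_Icc_self (C.B.Ioo_subset_Ioo_lo hyhi)) hgy
  rw [BasinSetting.coneMap_def, ← hdir, ← h1]
  exact C.B.conePt_dir_eq_levelProj hwnc hsph (Ioo_subset_Icc_self (C.B.Ioo_subset_Ioo_lo hyhi)) ⟨t, hgy⟩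

end BasinCouple

end Literature.Topology.FourManifolds
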